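import Summits.AnomalousDissipation.AnomalousDissipation.Theses.SteadyMirrorGate
import Literature.Analysis.FluidPDE.EnergySpaceRellich
import Literature.Analysis.FluidPDE.SteadyNavierStokesProofs
import Literature.Analysis.FluidPDE.CylindricalGenerator

/-!
# Route SteadyMirrorGate — support `TameMirrorLimitTG` (stmt-AnomalousDissipation-33833), proved

T «TAME MIRROR LIMIT» (the Rellich passage; binder `hT` of the route's deciding theorem `closes`).
At the pinned Taylor–Green force `f_TG`: if `u_n ∈ V` are K-symmetric steady weak solutions of
`NS_{ν_n}(f_TG)` (`ν_n > 0`, `ν_n → 0`) with spectral enstrophy `eGradNormSq u_n ≤ M` for all `n`, then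
some `v ∈ V ∩ Fix K` is a steady weak Euler state of `f_TG` (`IsSteadyWeakSolution 0 f_TG v`).

Proof.  The enstrophy ball `{w ∈ H | eGradNormSq w ≤ M}` is norm-compact in `H` (Rellich,
`Torus.isCompact_setOf_eGradNormSq_le`), so a subsequence `u_{ψ n} → v` in `H`; the limit has finite
enstrophy, hence lies in `V` (`Torus.memSobolev_one_complexify_of_eGradNormSq_ne_top`); the a.e. mirror
class `Fix K` is closed in `H` (`isClosed_mirrorClassK` below = the tree's
`PumpedMirrorMirrorFloorTG.stub_mirrorSlabClosed`, re-proved here so that this module imports no other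
Theorems module), so `v ∈ Fix K`; and for
each smooth solenoidal mean-zero test field `w` the tested generator splits as
`⟨F_0(u), w⟩ = ⟨F_ν(u), w⟩ − ν (u, Δw)`, where `⟨F_{ν_n}(u_n), w⟩ = 0` (steady weak solution),
`(u_{ψ n}, Δw) → (v, Δw)` (`Torus.continuous_pairing_coe`) and `ν_{ψ n} → 0`, so
`⟨F_0(u_{ψ n}), w⟩ → 0`; by norm-continuity of `u ↦ ⟨F_0(u), w⟩` on `H`
(`Torus.continuous_nsGeneratorPairing`) the limit is `⟨F_0(v), w⟩ = 0`.  The pinning hypothesis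
`f = f_TG` is not used: the passage holds for every force.

References: Foias–Manley–Rosa–Temam 2001, Ch. II §6 (Rellich on `H`), §7 (steady weak solutions)
[FMRTTurbulence2001]; Temam 1979, Ch. II §1 [Temam1979]; Robinson–Rodrigo–Sadowski 2016, Thm 1.19
[RobinsonRodrigoSadowski2016].  Template: `Theorems/TaylorCertificatesSteadyStatesLoudBoundedStubCompactnessSplit.lean`
Steps 3–4 (decomp-ad cell, lens-6 g57).
-/

-- `Summit.<Summit>.<Problem>` is the tree's mandated summit-side namespace (CONVENTIONS §2); single-conjunct summit, duplicate deliberate.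
set_option linter.dupNamespace false

noncomputable section

namespace Summit.AnomalousDissipation.AnomalousDissipation.Theorems

open MeasureTheory Filter Topology
open scoped InnerProductSpace ENNReal
open Literature.Analysis.FunctionSpaces Literature.Analysis.FluidPDE
open Literature.Analysis.FunctionSpaces.Torus Literature.Analysis.FluidPDE.Torus
open Summit.AnomalousDissipation.AnomalousDissipation.Theses.SteadyMirrorGate

/-- **The a.e. mirror class `Fix K ⊆ H` is closed** (each of the nine conditions
`(u ∘ σ_i)_j = (R_i u)_j` a.e. is sequentially closed: an `L²`-convergent sequence has an a.e.-convergent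
subsequence, which also converges a.e. along the measure-preserving reflection `σ_i`, and the pointwise
identities pass to the limit).  Verbatim the tree theorem `PumpedMirrorMirrorFloorTG.stub_mirrorSlabClosed`
(`Theorems/PumpedMirrorMirrorFloorTGStubMirrorSlabClosed.lean`), re-proved here to keep this module's imports
inside `Literature/` + the route file. [folklore] -/
theorem isClosed_mirrorClassK :
    IsClosed {u : energySpace (Fin 3) | ∀ i j : Fin 3,
      (fun x => (u.1 : UnitAddTorus (Fin 3) → EuclideanSpace ℝ (Fin 3)) (Function.update x i (-x i)) j)
        =ᵐ[volume]
      (fun x => if j = i then -((u.1 : UnitAddTorus (Fin 3) → EuclideanSpace ℝ (Fin 3)) x j)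
        else (u.1 : UnitAddTorus (Fin 3) → EuclideanSpace ℝ (Fin 3)) x j)} := by
  simp only [Set.setOf_forall]
  refine isClosed_iInter fun i => isClosed_iInter fun j => IsSeqClosed.isClosed ?_
  -- the reflection `σ_i` preserves the Haar measure of `T³` (product of `−id` and identities)
  have hσ : MeasurePreserving (fun x : UnitAddTorus (Fin 3) => Function.update x i (-x i))
      volume volume := by
    have h := volume_preserving_pi (α' := fun _ : Fin 3 => UnitAddCircle)
      (β' := fun _ : Fin 3 => UnitAddCircle)
      (f := fun k => if k = i then (Neg.neg : UnitAddCircle → UnitAddCircle) else id) (fun k => by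
        split_ifs
        · exact Measure.measurePreserving_neg _
        · exact MeasurePreserving.id _)
    have heq : (fun (x : UnitAddTorus (Fin 3)) (k : Fin 3) =>
        (if k = i then (Neg.neg : UnitAddCircle → UnitAddCircle) else id) (x k)) =
        fun x => Function.update x i (-x i) := by
      funext x k
      by_cases hk : k = i
      · subst hk
        simp
      · simp [hk]
    rwa [heq] at h
  intro U u hU hUu
  simp only [Set.mem_setOf_eq] at hU ⊢
  -- `U n → u` in `H`, hence in `L²`, hence a subsequence converges almost everywhere
  have h1 : Tendsto (fun n => ((U n).1 : Lp (EuclideanSpace ℝ (Fin 3)) 2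
      (volume : Measure (UnitAddTorus (Fin 3))))) atTop (𝓝 u.1) :=
    (continuous_subtype_val.tendsto u).comp hUu
  obtain ⟨ns, -, hae⟩ := (tendstoInMeasure_of_tendsto_Lp h1).exists_seq_tendsto_ae
  -- … and also almost everywhere along the measure-preserving reflection `σ_i`
  have hae' : ∀ᵐ x ∂(volume : Measure (UnitAddTorus (Fin 3))),
      Tendsto (fun k => ((U (ns k)).1 : UnitAddTorus (Fin 3) → EuclideanSpace ℝ (Fin 3))
        (Function.update x i (-x i))) atTop
        (𝓝 ((u.1 : UnitAddTorus (Fin 3) → EuclideanSpace ℝ (Fin 3))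
          (Function.update x i (-x i)))) :=
    hσ.quasiMeasurePreserving.ae hae
  have hmem : ∀ᵐ x ∂(volume : Measure (UnitAddTorus (Fin 3))), ∀ k,
      ((U (ns k)).1 : UnitAddTorus (Fin 3) → EuclideanSpace ℝ (Fin 3))
          (Function.update x i (-x i)) j =
        if j = i then -(((U (ns k)).1 : UnitAddTorus (Fin 3) → EuclideanSpace ℝ (Fin 3)) x j)
        else ((U (ns k)).1 : UnitAddTorus (Fin 3) → EuclideanSpace ℝ (Fin 3)) x j :=
    ae_all_iff.2 fun k => hU (ns k)
  have hproj : Continuous fun v : EuclideanSpace ℝ (Fin 3) => v j := (EuclideanSpace.proj j).continuous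
  filter_upwards [hae, hae', hmem] with x hx hx' hxm
  -- pass to the limit in the pointwise identities along the subsequence
  have h2 : Tendsto (fun k =>
      if j = i then -(((U (ns k)).1 : UnitAddTorus (Fin 3) → EuclideanSpace ℝ (Fin 3)) x j)
      else ((U (ns k)).1 : UnitAddTorus (Fin 3) → EuclideanSpace ℝ (Fin 3)) x j) atTop
      (𝓝 (if j = i then -((u.1 : UnitAddTorus (Fin 3) → EuclideanSpace ℝ (Fin 3)) x j)
        else (u.1 : UnitAddTorus (Fin 3) → EuclideanSpace ℝ (Fin 3)) x j)) := by
    split_ifs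
    · exact ((hproj.tendsto _).comp hx).neg
    · exact (hproj.tendsto _).comp hx
  exact tendsto_nhds_unique ((hproj.tendsto _).comp hx') (h2.congr fun k => (hxm k).symm)

/-- Splitting off the viscous term of the tested generator:
`⟨F_0(u), w⟩ = ⟨F_ν(u), w⟩ − ν (u, Δw)`. [folklore] -/
theorem nsGeneratorPairing_zero_eq_sub (ν : ℝ) (f : UnitAddTorus (Fin 3) → EuclideanSpace ℝ (Fin 3))
    (u : energySpace (Fin 3)) (w : UnitAddTorus (Fin 3) → EuclideanSpace ℝ (Fin 3)) :
    nsGeneratorPairing 0 f u w =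
      nsGeneratorPairing ν f u w - ν * pairing (u : Lp (EuclideanSpace ℝ (Fin 3)) 2 (volume : Measure (UnitAddTorus (Fin 3)))) (Torus.laplacian w) := by
  unfold nsGeneratorPairing pairing
  ring

/-- **TAME LIMIT PASSAGE (any force).**  Steady weak solutions `u_n ∈ H` of `NS_{ν_n}(f)` with
`ν_n → 0`, lying in a closed set `S ⊆ H` and in a fixed enstrophy ball `eGradNormSq u_n ≤ M`, have an
`H`-limit point `v ∈ V ∩ S` which is a steady weak Euler state of `f`. [folklore] -/
theorem exists_steadyWeakEuler_of_enstrophy_le (f : UnitAddTorus (Fin 3) → EuclideanSpace ℝ (Fin 3))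
    (S : Set (energySpace (Fin 3))) (hS : IsClosed S) (M : ℝ) (ν : ℕ → ℝ) (u : ℕ → energySpace (Fin 3))
    (hνlim : Tendsto ν atTop (𝓝 0))
    (hsol : ∀ n, IsSteadyWeakSolution (ν n) f (u n))
    (hmem : ∀ n, u n ∈ S)
    (hens : ∀ n, eGradNormSq ((u n : Lp (EuclideanSpace ℝ (Fin 3)) 2 (volume : Measure (UnitAddTorus (Fin 3)))) : UnitAddTorus (Fin 3) → EuclideanSpace ℝ (Fin 3)) ≤
      ENNReal.ofReal M) :
    ∃ v : energySpace (Fin 3), (v : Lp (EuclideanSpace ℝ (Fin 3)) 2 (volume : Measure (UnitAddTorus (Fin 3)))) ∈ energySpaceV (Fin 3) ∧ v ∈ S ∧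
      IsSteadyWeakSolution 0 f v := by
  -- Rellich: the enstrophy ball is compact in `H`; extract a convergent subsequence
  set K : Set (energySpace (Fin 3)) :=
    {w | eGradNormSq ((w : Lp (EuclideanSpace ℝ (Fin 3)) 2 (volume : Measure (UnitAddTorus (Fin 3)))) : UnitAddTorus (Fin 3) → EuclideanSpace ℝ (Fin 3)) ≤
      ENNReal.ofReal M} with hK
  have hKc : IsCompact K := isCompact_setOf_eGradNormSq_le ENNReal.ofReal_ne_top
  have hUK : ∀ n, u n ∈ K := fun n => hens n
  obtain ⟨v₀, hv₀K, ψ, hψ, hlim⟩ := hKc.tendsto_subseq hUK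
  refine ⟨v₀, ?_, ?_, ?_⟩
  · -- finite enstrophy ⇒ `v₀ ∈ V`
    exact ⟨v₀.2, memSobolev_one_complexify_of_eGradNormSq_ne_top (Lp.memLp _)
      (ne_top_of_le_ne_top ENNReal.ofReal_ne_top hv₀K)⟩
  · -- `S` is closed
    exact hS.mem_of_tendsto hlim (Eventually.of_forall fun n => hmem (ψ n))
  · -- the limit is a steady weak Euler state
    intro w hw hwd hwm
    have hA : Tendsto (fun n => nsGeneratorPairing 0 f (u (ψ n)) w) atTop
        (𝓝 (nsGeneratorPairing 0 f v₀ w)) :=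
      ((continuous_nsGeneratorPairing 0 f hw).tendsto v₀).comp hlim
    have hP : Tendsto (fun n => pairing ((u (ψ n) : Lp (EuclideanSpace ℝ (Fin 3)) 2 (volume : Measure (UnitAddTorus (Fin 3))))) (Torus.laplacian w)) atTop
        (𝓝 (pairing (v₀ : Lp (EuclideanSpace ℝ (Fin 3)) 2 (volume : Measure (UnitAddTorus (Fin 3)))) (Torus.laplacian w))) :=
      ((continuous_pairing_coe (hw.laplacian.memLp 2)).tendsto v₀).comp hlim
    have hνψ : Tendsto (fun n => ν (ψ n)) atTop (𝓝 0) := hνlim.comp hψ.tendsto_atTop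
    have hB : Tendsto (fun n => nsGeneratorPairing 0 f (u (ψ n)) w) atTop (𝓝 0) := by
      have h1 : Tendsto (fun n => ν (ψ n) * pairing ((u (ψ n) : Lp (EuclideanSpace ℝ (Fin 3)) 2 (volume : Measure (UnitAddTorus (Fin 3))))) (Torus.laplacian w))
          atTop (𝓝 0) := by
        have h := hνψ.mul hP
        rw [zero_mul] at h
        exact h
      have h2 : (fun n => nsGeneratorPairing 0 f (u (ψ n)) w) =
          fun n => 0 - ν (ψ n) * pairing ((u (ψ n) : Lp (EuclideanSpace ℝ (Fin 3)) 2 (volume : Measure (UnitAddTorus (Fin 3))))) (Torus.laplacian w) := by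
        funext n
        rw [nsGeneratorPairing_zero_eq_sub (ν (ψ n)) f (u (ψ n)) w, hsol (ψ n) w hw hwd hwm]
      rw [h2]
      have h3 := (tendsto_const_nhds (x := (0 : ℝ))).sub h1
      rw [sub_zero] at h3
      exact h3
    exact tendsto_nhds_unique hA hB

/-- **Route decl `SteadyMirrorGate.TameMirrorLimitTG` (stmt-AnomalousDissipation-33833), proved** — the
Rellich passage at the pinned Taylor–Green force inside the closed mirror class `Fix K`. [folklore] -/
theorem steadyMirrorGate_tameMirrorLimitTG_holds : TameMirrorLimitTG := by
  intro f _hf M ν u _hν hνlim hu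
  obtain ⟨v, hV, hK, hsol⟩ := exists_steadyWeakEuler_of_enstrophy_le f
    {w : energySpace (Fin 3) | ∀ i j : Fin 3,
      (fun x => ((w : Lp (EuclideanSpace ℝ (Fin 3)) 2 (volume : Measure (UnitAddTorus (Fin 3)))) : UnitAddTorus (Fin 3) → EuclideanSpace ℝ (Fin 3))
        (Function.update x i (-x i)) j) =ᵐ[volume]
      (fun x => if j = i then -(((w : Lp (EuclideanSpace ℝ (Fin 3)) 2 (volume : Measure (UnitAddTorus (Fin 3)))) : UnitAddTorus (Fin 3) → EuclideanSpace ℝ (Fin 3)) x j)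
        else ((w : Lp (EuclideanSpace ℝ (Fin 3)) 2 (volume : Measure (UnitAddTorus (Fin 3)))) : UnitAddTorus (Fin 3) → EuclideanSpace ℝ (Fin 3)) x j)}
    isClosed_mirrorClassK M ν u hνlim (fun n => (hu n).2.1)
    (fun n => (hu n).2.2.1) (fun n => (hu n).2.2.2)
  exact ⟨v, hV, hK, hsol⟩

end Summit.AnomalousDissipation.AnomalousDissipation.Theorems

end
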